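import Mathlib
import Summits.ValiantsHypothesis.ValiantsHypothesis.Theorems.KPlusLogSqLawWeakLiftingTowerGraftSignedCrossingSignature

/-!
# Tower graft line — SIGNED CROSSINGS IX: DEGENERATE crossings — the flux is the signature up to the nullity of the kernel form

Structure file for LINE (B) `Cruxes/WeakLifting/Lines/tower_graft.lean` (crux `WeakLifting` = stmt-ValiantsHypothesis-19561),
ninth of the SIGNED-CROSSING series.  Files III–VIII need every root to be a REGULAR crossing.  Here the kernel crossing form may be
DEGENERATE (isotropic kernel directions = the folds of the line's memo T3): the user supplies, at each root `t`, ANY frames `Qp t`, `Qm t`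
in `ker H(t)` on which `H′ t` is positive, resp. negative (no completeness condition).  Then the spectral flow is pinned between the two
partial signatures: with `k₊ = |κp t|`, `k₋ = |κm t|`, `k₀ = ν₀ − k₊ − k₋` (the unaccounted kernel directions),
`Σ_t (k₊ − k₋ − k₀) ≤ ν₋(a) − ν₋(b) ≤ Σ_t (k₊ − k₋ + k₀)` — EACH ISOTROPIC KERNEL DIRECTION ABSORBS AT MOST ONE UNIT OF FLUX.

§1 THE INEQUALITY ENGINE from one-sided local bounds (`negCount_single_crossing_bounds`, ★ `sum_lo_add_negCount_le`): data `kLlo kLhi kRlo kRhi : ℝ → ℕ` with, at every point of the finite set `T ⊇ roots of (a, b)`,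
   `ν₋(t) + kLlo t ≤ ν₋(u) ≤ ν₋(t) + kLhi t` just left of `t` and `ν₋(t) + kRlo t ≤ ν₋(u) ≤ ν₋(t) + kRhi t` just right of `t` ⇒
   `Σ kLlo + ν₋(b) ≤ Σ kRhi + ν₋(a)` and `Σ kRlo + ν₋(a) ≤ Σ kLhi + ν₋(b)` (`a, b` non-roots; roots need only be finite, NOT isolated by
   transversality — the covering finset isolates them).
§2 ★★ THE DEGENERATE-TOLERANT LAW `two_mul_sum_card_add_negCount_le` (both inequalities):
   `Σ_t 2|κp t| + ν₋(b) ≤ Σ_t ν₀(t) + ν₋(a)` and `Σ_t 2|κm t| + ν₋(a) ≤ Σ_t ν₀(t) + ν₋(b)` (the two displayed inequalities, cleared of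
   subtraction); with `|κp| + |κm| = ν₀` at every root both collapse to file VIII's identity; `negCount_dist_le_sum_zeroCount` — with no
   frame data at all, `|ν₋(a) − ν₋(b)| ≤ Σ_{roots} ν₀` (only finiteness of the roots is used).
READING FOR THE LINE (honest): for a one-letter graft, a root whose kernel vector(s) are ISOTROPIC for the co-Euler base (a fold of
`T ↦ det(G(t) + TS)` in the memo's (t, T)-picture) loosens the balance law by one unit per isotropic direction; the flux through a zone is the
co-Euler signature count up to the total fold multiplicity met.  No count of folds is claimed (that is T3).  Zero stub credit; S4/S5, TowerB,
WeakLifting, Conjecture B, 18050, VP ≠ VNP untouched.  Def-free; Mathlib + files I–VIII.  Seat: prover val-sym-lift-p2 g24,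
`--supports stmt-ValiantsHypothesis-19561 --as helper`.  [folklore one-sided perturbation bounds; the packaging for the line is this work]
-/

-- `Summit.ValiantsHypothesis.ValiantsHypothesis.…` repeats a component by the D-0017 layout
-- (single-conjunct summit), which the `dupNamespace` linter flags; the name is mandated.
set_option linter.dupNamespace false
set_option autoImplicit false

namespace Summit.ValiantsHypothesis.ValiantsHypothesis.Theorems.KPlusLogSqLaw.TowerGraft

open Matrix Finset Filter
open scoped BigOperators Topology
open Literature.Algebra.Polynomial.MiddleMatrixSignature (card_eigenvalues_neg_add_zero_add_pos)

namespace SignedCrossing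

variable {ι : Type} [Fintype ι] [DecidableEq ι]

/-! ## §1 The inequality engine -/

section Engine

/-- **one crossing between two non-roots, with one-sided bounds**: `c < t₀ < d`, `(c, d) ∖ {t₀}` root-free, `det H c ≠ 0 ≠ det H d`, and at `t₀`
the four eventual bounds ⇒ `ν₋(t₀) + kLlo ≤ ν₋(c) ≤ ν₋(t₀) + kLhi` and `ν₋(t₀) + kRlo ≤ ν₋(d) ≤ ν₋(t₀) + kRhi`. [this work] -/
theorem negCount_single_crossing_bounds (H H' : ℝ → Matrix ι ι ℝ) (hH : ∀ u, (H u).IsHermitian) {a b : ℝ}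
    (hd : ∀ u, a ≤ u → u ≤ b → ∀ i j, HasDerivAt (fun x => H x i j) (H' u i j) u)
    {c t₀ d : ℝ} (hac : a ≤ c) (hct : c < t₀) (htd : t₀ < d) (hdb : d ≤ b) (hc0 : (H c).det ≠ 0) (hd0 : (H d).det ≠ 0)
    (hfree : ∀ u, c < u → u < d → u ≠ t₀ → (H u).det ≠ 0) {kLlo kLhi kRlo kRhi : ℕ}
    (hLlo : ∀ᶠ u in 𝓝[<] t₀, (univ.filter fun i => (hH t₀).eigenvalues i < 0).card + kLlo ≤ (univ.filter fun i => (hH u).eigenvalues i < 0).card)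
    (hLhi : ∀ᶠ u in 𝓝[<] t₀, (univ.filter fun i => (hH u).eigenvalues i < 0).card ≤ (univ.filter fun i => (hH t₀).eigenvalues i < 0).card + kLhi)
    (hRlo : ∀ᶠ u in 𝓝[>] t₀, (univ.filter fun i => (hH t₀).eigenvalues i < 0).card + kRlo ≤ (univ.filter fun i => (hH u).eigenvalues i < 0).card)
    (hRhi : ∀ᶠ u in 𝓝[>] t₀, (univ.filter fun i => (hH u).eigenvalues i < 0).card ≤ (univ.filter fun i => (hH t₀).eigenvalues i < 0).card + kRhi) :
    ((univ.filter fun i => (hH t₀).eigenvalues i < 0).card + kLlo ≤ (univ.filter fun i => (hH c).eigenvalues i < 0).card ∧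
      (univ.filter fun i => (hH c).eigenvalues i < 0).card ≤ (univ.filter fun i => (hH t₀).eigenvalues i < 0).card + kLhi) ∧
    ((univ.filter fun i => (hH t₀).eigenvalues i < 0).card + kRlo ≤ (univ.filter fun i => (hH d).eigenvalues i < 0).card ∧
      (univ.filter fun i => (hH d).eigenvalues i < 0).card ≤ (univ.filter fun i => (hH t₀).eigenvalues i < 0).card + kRhi) := by
  constructor
  · -- sample a point of `(c, t₀)` inside both left-eventual sets; `ν₋` is constant on `[c, u]`
    obtain ⟨L, hL, hLsub⟩ := mem_nhdsLT_iff_exists_Ioo_subset.mp (hLlo.and hLhi)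
    rw [Set.mem_Iio] at hL
    set u : ℝ := (max L c + t₀) / 2 with hu
    have hM : max L c < t₀ := max_lt hL hct
    have hM1 : L ≤ max L c := le_max_left _ _; have hM2 : c ≤ max L c := le_max_right _ _
    have hLu : L < u := by rw [hu]; linarith
    have hcu : c < u := by rw [hu]; linarith
    have hut : u < t₀ := by rw [hu]; linarith
    have h12 := hLsub ⟨hLu, hut⟩
    simp only [Set.mem_setOf_eq] at h12
    have hconst := negCount_eq_of_forall_det_ne_zero H H' hH hd hac hcu.le (hut.le.trans (htd.le.trans hdb)) fun w hw1 hw2 h0 => by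
      rcases hw1.eq_or_lt with rfl | hlt
      · exact hc0 h0
      · exact hfree w hlt (lt_of_le_of_lt hw2 (hut.trans htd)) (ne_of_lt (lt_of_le_of_lt hw2 hut)) h0
    omega
  · obtain ⟨R, hR, hRsub⟩ := mem_nhdsGT_iff_exists_Ioo_subset.mp (hRlo.and hRhi)
    rw [Set.mem_Ioi] at hR
    set u : ℝ := (t₀ + min R d) / 2 with hu
    have hm : t₀ < min R d := lt_min hR htd
    have hm1 : min R d ≤ R := min_le_left _ _; have hm2 : min R d ≤ d := min_le_right _ _
    have htu : t₀ < u := by rw [hu]; linarith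
    have huR : u < R := by rw [hu]; linarith
    have hud : u < d := by rw [hu]; linarith
    have h12 := hRsub ⟨htu, huR⟩
    simp only [Set.mem_setOf_eq] at h12
    have hconst := negCount_eq_of_forall_det_ne_zero H H' hH hd (hac.trans (hct.le.trans htu.le)) hud.le hdb fun w hw1 hw2 h0 => by
      rcases hw2.eq_or_lt with rfl | hlt
      · exact hd0 h0
      · exact hfree w (hct.trans (htu.trans_le hw1)) hlt (ne_of_gt (htu.trans_le hw1)) h0
    omega

/-- **THE INEQUALITY ENGINE.**  Entries differentiable on `[a, b]`, `a, b` non-roots, `T ⊆ (a, b)` finite containing the roots of `det H` in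
`(a, b)`, and at every `t ∈ T` the four one-sided eventual bounds with data `kLlo, kLhi, kRlo, kRhi`.  Then
`Σ_{t ∈ T} kLlo t + ν₋(b) ≤ Σ_{t ∈ T} kRhi t + ν₋(a)` and `Σ_{t ∈ T} kRlo t + ν₋(a) ≤ Σ_{t ∈ T} kLhi t + ν₋(b)`. [this work] -/
theorem sum_lo_add_negCount_le (H H' : ℝ → Matrix ι ι ℝ) (hH : ∀ u, (H u).IsHermitian) {a b : ℝ}
    (hd : ∀ u, a ≤ u → u ≤ b → ∀ i j, HasDerivAt (fun x => H x i j) (H' u i j) u)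
    (hab : a ≤ b) (ha0 : (H a).det ≠ 0) (hb0 : (H b).det ≠ 0)
    (T : Finset ℝ) (hT : ∀ t ∈ T, a < t ∧ t < b) (hcov : ∀ u, a < u → u < b → (H u).det = 0 → u ∈ T) (kLlo kLhi kRlo kRhi : ℝ → ℕ)
    (hLlo : ∀ t ∈ T, ∀ᶠ u in 𝓝[<] t,
      (univ.filter fun i => (hH t).eigenvalues i < 0).card + kLlo t ≤ (univ.filter fun i => (hH u).eigenvalues i < 0).card)
    (hLhi : ∀ t ∈ T, ∀ᶠ u in 𝓝[<] t,
      (univ.filter fun i => (hH u).eigenvalues i < 0).card ≤ (univ.filter fun i => (hH t).eigenvalues i < 0).card + kLhi t)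
    (hRlo : ∀ t ∈ T, ∀ᶠ u in 𝓝[>] t,
      (univ.filter fun i => (hH t).eigenvalues i < 0).card + kRlo t ≤ (univ.filter fun i => (hH u).eigenvalues i < 0).card)
    (hRhi : ∀ t ∈ T, ∀ᶠ u in 𝓝[>] t,
      (univ.filter fun i => (hH u).eigenvalues i < 0).card ≤ (univ.filter fun i => (hH t).eigenvalues i < 0).card + kRhi t) :
    (∑ t ∈ T, kLlo t) + (univ.filter fun i => (hH b).eigenvalues i < 0).card ≤
        (∑ t ∈ T, kRhi t) + (univ.filter fun i => (hH a).eigenvalues i < 0).card ∧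
      (∑ t ∈ T, kRlo t) + (univ.filter fun i => (hH a).eigenvalues i < 0).card ≤
        (∑ t ∈ T, kLhi t) + (univ.filter fun i => (hH b).eigenvalues i < 0).card := by
  classical
  suffices key : ∀ b', a ≤ b' → b' ≤ b → (H b').det ≠ 0 → (∀ t ∈ T, a < t ∧ t < b') →
      (∀ u, a < u → u < b' → (H u).det = 0 → u ∈ T) →
      (∑ t ∈ T, kLlo t) + (univ.filter fun i => (hH b').eigenvalues i < 0).card ≤
          (∑ t ∈ T, kRhi t) + (univ.filter fun i => (hH a).eigenvalues i < 0).card ∧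
        (∑ t ∈ T, kRlo t) + (univ.filter fun i => (hH a).eigenvalues i < 0).card ≤
          (∑ t ∈ T, kLhi t) + (univ.filter fun i => (hH b').eigenvalues i < 0).card from key b hab le_rfl hb0 hT hcov
  -- keep the local data hypotheses (indexed by membership in the shrinking finset) through the induction
  clear hT hcov
  induction T using Finset.induction_on_max with
  | empty =>
    intro b' hab' hb'b hb'0 _ hcov'
    simp only [Finset.sum_empty, zero_add]
    have h := negCount_eq_of_forall_det_ne_zero H H' hH hd le_rfl hab' hb'b fun u hu1 hu2 h0 => by
      rcases hu1.eq_or_lt with rfl | hlt1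
      · exact ha0 h0
      rcases hu2.eq_or_lt with rfl | hlt2
      · exact hb'0 h0
      exact (Finset.notMem_empty u) (hcov' u hlt1 hlt2 h0)
    omega
  | insert t₀ S hlt ih =>
    intro b' hab' hb'b hb'0 hT' hcov'
    have ht₀ := hT' t₀ (Finset.mem_insert_self _ _)
    have ht₀S : t₀ ∉ S := fun h => lt_irrefl _ (hlt t₀ h)
    have hS : ∀ t ∈ S, t ∈ insert t₀ S := fun t ht => Finset.mem_insert_of_mem ht
    obtain ⟨lo, halo, hlot₀, hSlo, hlofree⟩ : ∃ lo, a ≤ lo ∧ lo < t₀ ∧ (∀ t ∈ S, t ≤ lo) ∧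
        (∀ u, lo < u → u < t₀ → (H u).det ≠ 0) := by
      rcases S.eq_empty_or_nonempty with hSe | hSne
      · refine ⟨a, le_rfl, ht₀.1, fun t ht => ?_, fun u hu1 hu2 h0 => ?_⟩
        · rw [hSe] at ht
          exact absurd ht (Finset.notMem_empty t)
        · have hu := hcov' u hu1 (hu2.trans ht₀.2) h0
          rw [hSe] at hu
          rcases Finset.mem_insert.mp hu with rfl | hu'
          · exact lt_irrefl _ hu2
          · exact Finset.notMem_empty u hu'
      · refine ⟨S.max' hSne, (hT' _ (hS _ (Finset.max'_mem S hSne))).1.le, hlt _ (Finset.max'_mem S hSne),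
          fun t ht => Finset.le_max' S t ht, fun u hu1 hu2 h0 => ?_⟩
        have hu := hcov' u ((hT' _ (hS _ (Finset.max'_mem S hSne))).1.trans hu1) (hu2.trans ht₀.2) h0
        rcases Finset.mem_insert.mp hu with rfl | hu'
        · exact lt_irrefl _ hu2
        · exact not_le.mpr hu1 (Finset.le_max' S u hu')
    set b'' : ℝ := (lo + t₀) / 2 with hb''
    have hlob'' : lo < b'' := by rw [hb'']; linarith
    have hb''t₀ : b'' < t₀ := by rw [hb'']; linarith
    have hb''0 : (H b'').det ≠ 0 := hlofree b'' hlob'' hb''t₀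
    have hIH := ih (fun t ht => hLlo t (hS t ht)) (fun t ht => hLhi t (hS t ht)) (fun t ht => hRlo t (hS t ht))
      (fun t ht => hRhi t (hS t ht)) b'' (halo.trans hlob''.le) (hb''t₀.le.trans (ht₀.2.le.trans hb'b)) hb''0
      (fun t ht => ⟨(hT' t (hS t ht)).1, lt_of_le_of_lt (hSlo t ht) hlob''⟩)
      (fun u hu1 hu2 h0 => by
        have hu := hcov' u hu1 (hu2.trans (hb''t₀.trans ht₀.2)) h0
        rcases Finset.mem_insert.mp hu with rfl | hu'
        · exact absurd (hu2.trans hb''t₀) (lt_irrefl _)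
        · exact hu')
    have hX := negCount_single_crossing_bounds H H' hH hd (halo.trans hlob''.le) hb''t₀ ht₀.2 hb'b hb''0 hb'0
      (fun u hu1 hu2 hne h0 => by
        have hu := hcov' u (lt_trans (halo.trans_lt hlob'') hu1) hu2 h0
        rcases Finset.mem_insert.mp hu with rfl | hu'
        · exact hne rfl
        · exact not_le.mpr (hlob''.trans hu1) (hSlo u hu'))
      (hLlo t₀ (Finset.mem_insert_self _ _)) (hLhi t₀ (Finset.mem_insert_self _ _))
      (hRlo t₀ (Finset.mem_insert_self _ _)) (hRhi t₀ (Finset.mem_insert_self _ _))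
    rw [Finset.sum_insert ht₀S, Finset.sum_insert ht₀S, Finset.sum_insert ht₀S, Finset.sum_insert ht₀S]
    omega

end Engine

/-! ## §2 The degenerate-tolerant law -/

section Degenerate

/-- **DEGENERATE-TOLERANT SIGNED-CROSSING LAW.**  `H` real symmetric, entries differentiable on `[a, b]`, `a, b` non-roots, `T ⊆ (a, b)` finite
containing the roots of `det H` in `(a, b)`; for each `t ∈ T`, ANY frames `Qp t`, `Qm t` in `ker H(t)` on which `H′ t` is positive, resp.
negative (no completeness required).  Then
`Σ_{t ∈ T} 2|κp t| + ν₋(b) ≤ Σ_{t ∈ T} ν₀(t) + ν₋(a)`  and  `Σ_{t ∈ T} 2|κm t| + ν₋(a) ≤ Σ_{t ∈ T} ν₀(t) + ν₋(b)`: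
the flux `ν₋(a) − ν₋(b)` differs from the partial signature `Σ (|κp| − |κm|)` by at most the unaccounted kernel mass `Σ (ν₀ − |κp| − |κm|)`.
[folklore one-sided perturbation bounds; packaging this work] -/
theorem two_mul_sum_card_add_negCount_le (H H' : ℝ → Matrix ι ι ℝ) (hH : ∀ u, (H u).IsHermitian) {a b : ℝ}
    (hd : ∀ u, a ≤ u → u ≤ b → ∀ i j, HasDerivAt (fun x => H x i j) (H' u i j) u)
    (hab : a ≤ b) (ha0 : (H a).det ≠ 0) (hb0 : (H b).det ≠ 0)
    (T : Finset ℝ) (hT : ∀ t ∈ T, a < t ∧ t < b) (hcov : ∀ u, a < u → u < b → (H u).det = 0 → u ∈ T)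
    (κp κm : ℝ → Type) [∀ t, Fintype (κp t)] [∀ t, Fintype (κm t)]
    (Qp : ∀ t, Matrix ι (κp t) ℝ) (Qm : ∀ t, Matrix ι (κm t) ℝ)
    (hQpker : ∀ t ∈ T, ∀ c : κp t → ℝ, H t *ᵥ (Qp t *ᵥ c) = 0)
    (hQp : ∀ t ∈ T, ∀ c : κp t → ℝ, c ≠ 0 → 0 < (Qp t *ᵥ c) ⬝ᵥ H' t *ᵥ (Qp t *ᵥ c))
    (hQmker : ∀ t ∈ T, ∀ c : κm t → ℝ, H t *ᵥ (Qm t *ᵥ c) = 0)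
    (hQm : ∀ t ∈ T, ∀ c : κm t → ℝ, c ≠ 0 → (Qm t *ᵥ c) ⬝ᵥ H' t *ᵥ (Qm t *ᵥ c) < 0) :
    (∑ t ∈ T, 2 * Fintype.card (κp t)) + (univ.filter fun i => (hH b).eigenvalues i < 0).card ≤
        (∑ t ∈ T, (univ.filter fun i => (hH t).eigenvalues i = 0).card) + (univ.filter fun i => (hH a).eigenvalues i < 0).card ∧
      (∑ t ∈ T, 2 * Fintype.card (κm t)) + (univ.filter fun i => (hH a).eigenvalues i < 0).card ≤
        (∑ t ∈ T, (univ.filter fun i => (hH t).eigenvalues i = 0).card) + (univ.filter fun i => (hH b).eigenvalues i < 0).card := by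
  classical
  -- data: lo = the frame size; hi = ν₀ minus the opposite frame size (truncated)
  let kLlo : ℝ → ℕ := fun t => Fintype.card (κp t)
  let kRlo : ℝ → ℕ := fun t => Fintype.card (κm t)
  let kLhi : ℝ → ℕ := fun t => (univ.filter fun i => (hH t).eigenvalues i = 0).card - Fintype.card (κm t)
  let kRhi : ℝ → ℕ := fun t => (univ.filter fun i => (hH t).eigenvalues i = 0).card - Fintype.card (κp t)
  have hab' : ∀ t ∈ T, a ≤ t ∧ t ≤ b := fun t ht => ⟨(hT t ht).1.le, (hT t ht).2.le⟩
  have hLlo : ∀ t ∈ T, ∀ᶠ u in 𝓝[<] t,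
      (univ.filter fun i => (hH t).eigenvalues i < 0).card + kLlo t ≤ (univ.filter fun i => (hH u).eigenvalues i < 0).card := fun t ht =>
    eventually_negCount_add_card_le_left H hH t H' (hd t (hab' t ht).1 (hab' t ht).2) (Qp t) (hQpker t ht) (hQp t ht)
  have hRlo : ∀ t ∈ T, ∀ᶠ u in 𝓝[>] t,
      (univ.filter fun i => (hH t).eigenvalues i < 0).card + kRlo t ≤ (univ.filter fun i => (hH u).eigenvalues i < 0).card := fun t ht =>
    eventually_negCount_add_card_le_right H hH t H' (hd t (hab' t ht).1 (hab' t ht).2) (Qm t) (hQmker t ht) (hQm t ht)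
  have hLhi : ∀ t ∈ T, ∀ᶠ u in 𝓝[<] t,
      (univ.filter fun i => (hH u).eigenvalues i < 0).card ≤ (univ.filter fun i => (hH t).eigenvalues i < 0).card + kLhi t := by
    intro t ht
    have h := eventually_posCount_add_card_le_left H hH t H' (hd t (hab' t ht).1 (hab' t ht).2) (Qm t) (hQmker t ht) (hQm t ht)
    refine h.mono fun u hu => ?_
    have := card_eigenvalues_neg_add_zero_add_pos (hH t)
    have := card_eigenvalues_neg_add_zero_add_pos (hH u)
    simp only [kLhi]
    omega
  have hRhi : ∀ t ∈ T, ∀ᶠ u in 𝓝[>] t,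
      (univ.filter fun i => (hH u).eigenvalues i < 0).card ≤ (univ.filter fun i => (hH t).eigenvalues i < 0).card + kRhi t := by
    intro t ht
    have h := eventually_posCount_add_card_le_right H hH t H' (hd t (hab' t ht).1 (hab' t ht).2) (Qp t) (hQpker t ht) (hQp t ht)
    refine h.mono fun u hu => ?_
    have := card_eigenvalues_neg_add_zero_add_pos (hH t)
    have := card_eigenvalues_neg_add_zero_add_pos (hH u)
    simp only [kRhi]
    omega
  -- the frames fit inside the kernel: `|κp t| + |κm t| ≤ ν₀(t)` (sample one point left of `t`)
  have hfit : ∀ t ∈ T, Fintype.card (κp t) + Fintype.card (κm t) ≤ (univ.filter fun i => (hH t).eigenvalues i = 0).card := by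
    intro t ht
    have h1 := eventually_negCount_add_card_le_left H hH t H' (hd t (hab' t ht).1 (hab' t ht).2) (Qp t) (hQpker t ht) (hQp t ht)
    have h2 := eventually_posCount_add_card_le_left H hH t H' (hd t (hab' t ht).1 (hab' t ht).2) (Qm t) (hQmker t ht) (hQm t ht)
    obtain ⟨u, hu1, hu2⟩ := (h1.and h2).exists
    have := card_eigenvalues_neg_add_zero_add_pos (hH t)
    have := card_eigenvalues_neg_add_zero_add_pos (hH u)
    omega
  have hmain := sum_lo_add_negCount_le H H' hH hd hab ha0 hb0 T hT hcov kLlo kLhi kRlo kRhi hLlo hLhi hRlo hRhi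
  -- unpack the data
  have hsumRhi : (∑ t ∈ T, kRhi t) + ∑ t ∈ T, Fintype.card (κp t) ≤ ∑ t ∈ T, (univ.filter fun i => (hH t).eigenvalues i = 0).card := by
    rw [← Finset.sum_add_distrib]
    refine Finset.sum_le_sum fun t ht => ?_
    have := hfit t ht
    simp only [kRhi]
    omega
  have hsumLhi : (∑ t ∈ T, kLhi t) + ∑ t ∈ T, Fintype.card (κm t) ≤ ∑ t ∈ T, (univ.filter fun i => (hH t).eigenvalues i = 0).card := by
    rw [← Finset.sum_add_distrib]
    refine Finset.sum_le_sum fun t ht => ?_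
    have := hfit t ht
    simp only [kLhi]
    omega
  have h2p : (∑ t ∈ T, 2 * Fintype.card (κp t)) = (∑ t ∈ T, kLlo t) + ∑ t ∈ T, Fintype.card (κp t) := by
    rw [← Finset.sum_add_distrib]
    exact Finset.sum_congr rfl fun t _ => by simp only [kLlo]; ring
  have h2m : (∑ t ∈ T, 2 * Fintype.card (κm t)) = (∑ t ∈ T, kRlo t) + ∑ t ∈ T, Fintype.card (κm t) := by
    rw [← Finset.sum_add_distrib]
    exact Finset.sum_congr rfl fun t _ => by simp only [kRlo]; ring
  constructor <;> omega

/-- corollary (flux within the unaccounted mass): with NO frame data at all, `|ν₋(a) − ν₋(b)| ≤ Σ_{roots} ν₀` — every root can move the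
negative inertia by at most its kernel dimension. [this work] -/
theorem negCount_dist_le_sum_zeroCount (H H' : ℝ → Matrix ι ι ℝ) (hH : ∀ u, (H u).IsHermitian) {a b : ℝ}
    (hd : ∀ u, a ≤ u → u ≤ b → ∀ i j, HasDerivAt (fun x => H x i j) (H' u i j) u)
    (hab : a ≤ b) (ha0 : (H a).det ≠ 0) (hb0 : (H b).det ≠ 0)
    (T : Finset ℝ) (hT : ∀ t ∈ T, a < t ∧ t < b) (hcov : ∀ u, a < u → u < b → (H u).det = 0 → u ∈ T) :
    (univ.filter fun i => (hH b).eigenvalues i < 0).card ≤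
        (∑ t ∈ T, (univ.filter fun i => (hH t).eigenvalues i = 0).card) + (univ.filter fun i => (hH a).eigenvalues i < 0).card ∧
      (univ.filter fun i => (hH a).eigenvalues i < 0).card ≤
        (∑ t ∈ T, (univ.filter fun i => (hH t).eigenvalues i = 0).card) + (univ.filter fun i => (hH b).eigenvalues i < 0).card := by
  have h := two_mul_sum_card_add_negCount_le H H' hH hd hab ha0 hb0 T hT hcov (fun _ => Fin 0) (fun _ => Fin 0)
    (fun _ => 0) (fun _ => 0) (fun t _ c => by simp [Matrix.mulVec_zero]) (fun t _ c hc => absurd (Subsingleton.elim c 0) hc)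
    (fun t _ c => by simp [Matrix.mulVec_zero]) (fun t _ c hc => absurd (Subsingleton.elim c 0) hc)
  simp only [Fintype.card_fin, mul_zero, Finset.sum_const_zero, zero_add] at h
  exact h

end Degenerate

end SignedCrossing

end Summit.ValiantsHypothesis.ValiantsHypothesis.Theorems.KPlusLogSqLaw.TowerGraft
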